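import Summits.CriticalPhenomena.SAWScalingLimit.Theorems.SAWLeftRightFKGFKGToTraversalBoundNecklaceEventual
import HarnessLib

/-!
# Vocabulary of line `slit-necklace` for crux `FKGToTraversalBound` (stmt-CriticalPhenomena-1878)

Route `route-CriticalPhenomena-SAWLeftRightFKG`, crux decl
`Summit.CriticalPhenomena.SAWScalingLimit.Theses.SAWLeftRightFKG.FKGToTraversalBound`
(`LeftRightFKG → SAWTraversalBound`).  This file is the SHARED VOCABULARY of the skeleton
`Cruxes/FKGToTraversalBound/Lines/slit_necklace.lean` (planner `crux-plan slit-necklace`, lead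
prover-line-stmt-CriticalPhenomena-1878-c4-0, 2026-08-16; stubs `stub_eventualShellReduction`,
`stub_hungPresentation`, `stub_engine`, `stub_criticalBubble`, `stub_slitNecklace`, `stub_germTight`,
`stub_wildDomains`), so that the stub proofs — one file each under
`Theorems/SAWLeftRightFKGFKGToTraversalBound*.lean` — state the registered signatures against the SAME
constants, and the final composition imports them (pattern of `SAWLeftRightFKGFKGToTraversalBoundGatesDefs.lean`
of the sibling line `gates-by-bubble-doors-by-fkg`).

Contents (namespace `Summit.CriticalPhenomena.SAWScalingLimit.Theorems.FKGToTraversalBound.SlitNecklace`),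
verbatim from the skeleton: `polyline γ` (the mesh polyline of a chord as a `Curve`), and the statements used as
HYPOTHESIS / CONCLUSION NAMES of the line's stubs (definitions, not literature facts and not restatements of
the crux): `EventualShellTight D a b` (per-shell eventual tightness of traversal counts for one endpoint
approximation), `GermTight D a b e` (germ tightness at a marked point: shrinking inner radius, fixed outer
radius), `TamePresentation Ω δ N₀` / `EventuallyTame D` (the lattice domain is an r2 graph up to `N₀` defect
sites), `HungPresentation` (every hung carrier is r2), `UniformShellTight` (output currency of the R1 engine:
uniform per-shell tightness over the r2 family with a static forcing allowance).

Definitions, plus ONE closed glue theorem (registered): `eventualShellTight_iff_shellTightOn` — the line's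
`EventualShellTight D a b` IS the sibling line's per-shell tightness currency `ShellTightOn (fun _ => True) 2 D a b`
(via the landed `necklace_shellTightOn_iff_eventually`, p126006), so the two round-2 lines exchange conclusions
verbatim.  No named literature fact.  `dom` is the tree's (`Theorems.FKGToTraversalBound.Negative.DeepEndpointGap`).
-/

noncomputable section

open MeasureTheory Filter Topology Set Metric
open scoped NNReal ENNReal
open Literature.Probability.LatticeModels
open Literature.Probability.RandomPlanarGeometry
open Literature.Probability.RandomPlanarGeometry.SAW
open Summit.CriticalPhenomena.SAWScalingLimit.Theorems.FKGToTraversalBound.Negative (dom)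

namespace Summit.CriticalPhenomena.SAWScalingLimit.Theorems.FKGToTraversalBound.SlitNecklace

/-- The mesh polyline of a chord, as a curve (`= ⟨γ.walk.toCurve (meshPoint δ)⟩`, reducible).
[folklore] -/
abbrev polyline {Ω : Set ℂ} {δ : ℝ} {u v : Site 2} (γ : DomainSAW Ω δ u v) : Curve ℂ :=
  ⟨γ.walk.toCurve (meshPoint δ)⟩

/-- **Per-shell EVENTUAL tightness** of the traversal counts of the critical chord, for ONE endpoint approximation:
for every fixed shell `D(x; ρ, R)` of modulus `≥ 2` (`0 < ρ`, `2ρ ≤ R ≤ 1`) and every `ε > 0` some threshold `n` has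
`P_δ(n separate traversals) ≤ ε` for all sufficiently small meshes.  No rate, no uniformity across shells, no `δ₀`
common to the shells — exactly what (H1) with a shell-dependent threshold needs (`stub_eventualShellReduction`).
[folklore] -/
def EventualShellTight (D : DobrushinDomain) (a b : ℝ → Site 2) : Prop :=
  ∀ (x : ℂ) (ρ R : ℝ), 0 < ρ → 2 * ρ ≤ R → R ≤ 1 → ∀ ε : ℝ, 0 < ε → ∃ n : ℕ, ∀ᶠ δ in 𝓝[>] (0 : ℝ),
    law D.carrier δ (a δ) (b δ) {γ | (polyline γ).HasTraversals n x ρ R} ≤ ENNReal.ofReal ε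

/-- **Germ tightness at the marked point approximated by `e`** (`e = a` or `e = b`; the rate-free bulk input of the
line): for every fixed outer radius `r > 0`, the number of separate traversals of the endpoint-centred shell
`D(δ·e_δ; ι(δ), r)` with the SHRINKING inner radius `ι(δ) = 2·dist(δ·e_δ, ℂ ∖ D) + 4δ` (twice the depth of the
lattice endpoint plus four meshes — enough to contain a shortest lattice slit from the boundary layer to `e_δ`, plus
one mesh) is tight, eventually in `δ`.  It counts the returns of the chord from distance `r` to the slit scale; on
the R1 class (`e_δ` a lattice-boundary vertex) the inner ball has `O(1)` sites and the count is bounded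
deterministically.  The OUTER radius is FIXED (macroscopic): unlike the crossover-annulus first moment
`GermExcursionMean` of the sibling line (both radii proportional to the depth, refuted on rosary domains by lead a3),
a fixed Jordan domain cannot force macroscopic oscillations at vanishing width (local connectedness of `∂D`).
Believed true for every endpoint approximation; NOT a consequence of (H1).
[folklore] -/
def GermTight (D : DobrushinDomain) (a b e : ℝ → Site 2) : Prop :=
  ∀ r : ℝ, 0 < r → ∀ ε : ℝ, 0 < ε → ∃ n : ℕ, ∀ᶠ δ in 𝓝[>] (0 : ℝ),
    law D.carrier δ (a δ) (b δ)
        {γ | (polyline γ).HasTraversals n (meshPoint δ (e δ))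
          (2 * infDist (meshPoint δ (e δ)) D.carrierᶜ + 4 * δ) r} ≤ ENNReal.ofReal ε

/-- **Tame presentation of the discretised domain at mesh `δ`**: after deleting a set `S` of at most `N₀` DEFECT
sites, the graph `Ω_δ = discreteDomainGraph Ω δ` IS the graph of an r2 carrier `dom C δ` (same adjacency; the form
consumed by the landed restriction identity `weight_restrict`).  Every deleted site adjacent to a remaining one is
then a vertex of `C`, so `S` is part of the ATTACHED spine of the necklace.  Defects that force `S ≠ ∅`: mesh edges
dropped because the segment leaves `closure Ω` (thin exterior bumps), exterior lattice sites enclosed by domain sites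
(thin exterior wedges at reflex corners), non-maximal mesh components.
[folklore] -/
def TamePresentation (Ω : Set ℂ) (δ : ℝ) (N₀ : ℕ) : Prop :=
  ∃ (c : Site 2) (C : (zdGraph 2).Walk c c) (S : Finset (Site 2)), S.card ≤ N₀ ∧
    ∀ x y : Site 2, (discreteDomainGraph (dom C δ) δ).Adj x y ↔
      ((discreteDomainGraph Ω δ).Adj x y ∧ x ∉ S ∧ y ∉ S)

/-- **Eventually tame Jordan domain**: one defect budget `N₀` works at all small meshes.  Believed to hold for every
piecewise-`C¹` Jordan domain with non-zero exterior angles (discs, smooth domains, polygons); fails for inward cusps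
and fractal boundaries — the WILD class of `stub_wildDomains`.
[folklore] -/
def EventuallyTame (D : DobrushinDomain) : Prop :=
  ∃ N₀ : ℕ, ∀ᶠ δ in 𝓝[>] (0 : ℝ), TamePresentation D.carrier δ N₀

/-- **Hung presentation** (the r2 half of the necklace disintegrations; body of `stub_hungPresentation`): for a
boundary walk `C`, mesh `δ > 0`, a target `b` and a finite set `K ∌ b` of sites each joined to a vertex of `C` by a
lattice walk through `K ∪ C.support` (ATTACHED), some closed walk `C'` through all vertices of `C` and all of `K`
presents the hung carrier: its graph is `Ω_δ = discreteDomainGraph (dom C δ) δ` restricted to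
`Keep(b, K) = {v | some walk v → b of Ω_δ avoids K}`.  (For a non-isolated target `b` this is the landed
`GatesByBubbleDoorsByFKG.necklace_hungPresentation` with `C' : c → c`.)
(HYPOTHESIS NAME of the line — a definition used as a stub hypothesis/conclusion, not a literature fact; status in the
line card `Cruxes/FKGToTraversalBound/Lines/slit-necklace.md`.) -/
def HungPresentation : Prop :=
  ∀ (δ : ℝ) (c b : Site 2) (C : (zdGraph 2).Walk c c) (K : Finset (Site 2)),
    0 < δ → b ∉ K →
    (∀ k ∈ K, ∃ (q : Site 2) (p : (zdGraph 2).Walk k q), q ∈ C.support ∧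
      ∀ x ∈ p.support, x ∈ K ∨ x ∈ C.support) →
    ∃ (c' : Site 2) (C' : (zdGraph 2).Walk c' c'),
      (∀ x ∈ C.support, x ∈ C'.support) ∧ (∀ k ∈ K, k ∈ C'.support) ∧
      ∀ x y : Site 2, (discreteDomainGraph (dom C' δ) δ).Adj x y ↔
        ((discreteDomainGraph (dom C δ) δ).Adj x y ∧
          (∃ q : (discreteDomainGraph (dom C δ) δ).Walk x b, ∀ v ∈ q.support, v ∉ K) ∧
          (∃ q : (discreteDomainGraph (dom C δ) δ).Walk y b, ∀ v ∈ q.support, v ∉ K))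

/-- **Uniform shell tightness over the r2 family** (the OUTPUT of the R1 engine, in the form the necklace consumes):
for every `ε > 0` and every forcing allowance `n₀` there is a threshold `n` such that in EVERY admissible carrier
(`δ > 0`, boundary walk `C`, endpoints `u ∼ u' ∈ C.support`, `v ∼ v' ∈ C.support` — verbatim the binders of
`LeftRightFKG`) and for EVERY shell `D(x; ρ, R)` with `δ ≤ ρ`, `2ρ ≤ R` admitting SOME chord with at most `n₀`
separate traversals (static allowance = Kemppainen–Smirnov's index at time zero), the critical chord makes `n`
separate traversals with probability `≤ ε`.  Uniform in the carrier, hence in every past, necklace and mesh.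
A uniform engine of this kind accepts the neck-and-room carriers and therefore needs the critical bubble
(`stub_engine` carries `CriticalBubbleBound`).
(HYPOTHESIS NAME of the line — a definition used as a stub hypothesis/conclusion, not a literature fact; OPEN, owned by
the sibling line `gates-by-bubble-doors-by-fkg`; status in the line card.) -/
def UniformShellTight : Prop :=
  ∀ ε : ℝ, 0 < ε → ∀ n₀ : ℕ, ∃ n : ℕ,
    ∀ (δ : ℝ) (c u v u' v' : Site 2) (C : (zdGraph 2).Walk c c),
      0 < δ → u' ∈ C.support → v' ∈ C.support → (zdGraph 2).Adj u u' → (zdGraph 2).Adj v v' →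
      ∀ (x : ℂ) (ρ R : ℝ), δ ≤ ρ → 2 * ρ ≤ R →
        (∃ γ₀ : DomainSAW (dom C δ) δ u v, ¬ (polyline γ₀).HasTraversals (n₀ + 1) x ρ R) →
        law (dom C δ) δ u v {γ | (polyline γ).HasTraversals n x ρ R} ≤ ENNReal.ofReal ε

/-- **Currency bridge (registered glue).**  Per-shell eventual tightness for one endpoint approximation, as this
line states it, is exactly the sibling line's `ShellTightOn` on the class of ALL meshes at modulus `2`
(`GatesByBubbleDoorsByFKG.necklace_shellTightOn_iff_eventually` with the trivial mesh class). -/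
theorem eventualShellTight_iff_shellTightOn :
    ∀ (D : DobrushinDomain) (a b : ℝ → Site 2),
      EventualShellTight D a b ↔ GatesByBubbleDoorsByFKG.ShellTightOn (fun _ => True) 2 D a b := by
  intro D a b
  rw [GatesByBubbleDoorsByFKG.necklace_shellTightOn_iff_eventually (P := fun _ => True) one_lt_two]
  refine forall₃_congr fun x ρ R => forall₃_congr fun _ _ _ => forall₂_congr fun ε _ => ?_
  refine exists_congr fun n => ?_
  constructor
  · intro h
    filter_upwards [h] with δ hδ _ using hδ
  · intro h
    filter_upwards [h] with δ hδ using hδ trivial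

/-! ## Reshape r2 (lead c4, 2026-08-16): the ROBUST static allowance

Wave-1 adjudication of `stub_engine` (worker, `work/stubs/stub_engine.md`): the same-shell static witness of
`UniformShellTight` is too weak — over the r2 family it is conjecturally junk-FALSE ("tip-squeeze meanders": outside-hung
walls whose tip `T_j` sits two rows above the inner circle leave ONE lattice site `S*_j` of their column strictly between
the tip and the closed `ρ`-ball; a witness chord hugging through every `S*_j` has `0` traversals, so `n₀ = 0` for every
number `m` of walls, while a chord missing `S*_j` must dip into the closed `ρ`-ball between two forced excursions beyond
`R`, paying `+2`; any uniform tip repulsion `P(visit S*_j) ≤ q < 1` — the route's own SLE₈⁄₃ belief — then gives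
`P(HasTraversals n) → 1` as `m → ∞` at fixed allowance).  The repair is Kemppainen–Smirnov's: the witness must avoid
traversals of the CONCENTRIC SUB-SHELL with margins `(R − ρ)/4`; then the squeeze witness itself pays, and the statement is
consistent with everything computed so far.  `UniformShellTight → UniformSubshellTight` (`HasTraversals.mono'`), so every
consumer of the old currency accepts the new one. -/

/-- **Uniform shell tightness over the r2 family, ROBUST allowance** (reshape r2 of the engine's output currency): as
`UniformShellTight`, but the static witness `γ₀` is asked to make at most `n₀` separate traversals of the concentric
SUB-shell `D(x; (3ρ + R)/4, (ρ + 3R)/4)` (margins `(R − ρ)/4` inside the shell `D(x; ρ, R)` whose traversals are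
bounded).  A traversal of the shell contains a traversal of the sub-shell (`Curve.HasTraversals.mono'`), so this
hypothesis is STRONGER than the same-shell allowance and the statement WEAKER than `UniformShellTight`
(`uniformSubshellTight_of_uniformShellTight`).
(HYPOTHESIS NAME of the line — a definition used as a stub hypothesis/conclusion, not a literature fact; OPEN, owned by
the sibling line `gates-by-bubble-doors-by-fkg` as a uniform-over-r2 lattice Kemppainen–Smirnov iteration; status in the
line card.) -/
def UniformSubshellTight : Prop :=
  ∀ ε : ℝ, 0 < ε → ∀ n₀ : ℕ, ∃ n : ℕ,
    ∀ (δ : ℝ) (c u v u' v' : Site 2) (C : (zdGraph 2).Walk c c),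
      0 < δ → u' ∈ C.support → v' ∈ C.support → (zdGraph 2).Adj u u' → (zdGraph 2).Adj v v' →
      ∀ (x : ℂ) (ρ R : ℝ), δ ≤ ρ → 2 * ρ ≤ R →
        (∃ γ₀ : DomainSAW (dom C δ) δ u v,
          ¬ (polyline γ₀).HasTraversals (n₀ + 1) x ((3 * ρ + R) / 4) ((ρ + 3 * R) / 4)) →
        law (dom C δ) δ u v {γ | (polyline γ).HasTraversals n x ρ R} ≤ ENNReal.ofReal ε

/-- **Old currency ⇒ robust currency (registered glue).**  A chord with at most `n₀` traversals of the sub-shell has at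
most `n₀` traversals of the shell (`Curve.HasTraversals.mono'`: the sub-shell is nested inside the shell, since
`ρ ≤ (3ρ + R)/4` and `(ρ + 3R)/4 ≤ R` when `ρ ≤ R`), so the robust allowance hypothesis implies the same-shell one and
`UniformShellTight` implies `UniformSubshellTight`. [folklore] -/
theorem uniformSubshellTight_of_uniformShellTight : UniformShellTight → UniformSubshellTight := by
  intro h ε hε n₀
  obtain ⟨n, hn⟩ := h ε hε n₀
  refine ⟨n, fun δ c u v u' v' C hδ hu' hv' huu' hvv' x ρ R hδρ h2 hw => ?_⟩
  refine hn δ c u v u' v' C hδ hu' hv' huu' hvv' x ρ R hδρ h2 ?_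
  obtain ⟨γ₀, hγ₀⟩ := hw
  refine ⟨γ₀, fun hk => hγ₀ (hk.mono' ?_ ?_)⟩
  · linarith
  · linarith

end Summit.CriticalPhenomena.SAWScalingLimit.Theorems.FKGToTraversalBound.SlitNecklace

end
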